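import Summits.QuantumFields.YangMills.Theorems.PoincareLipschitzTwoSidedOfConcentrationBudget
import Literature.MathematicalPhysics.QuantumFieldTheory.Balaban1983to89.T3AveragedTailProfile
import Literature.MathematicalPhysics.QuantumFieldTheory.Balaban1983to89.B2Prop31Thresholds
import HarnessLib

/-!
# Exponent bookkeeping for the local-insertion tail: Bałaban's `p`-function increments beat the local volumes
# (helper for the glue `HistoryTailOfInsertionL`, stmt-QuantumFields-23608, route `LocalInsertion`, planner ym-r3-idea-2 g7 LINE 16)

Route-independent real analysis for `p(g) = b₀(1 + log g⁻¹)^{p₀}` at the running couplings `g_h = √(γ L^{−h})` (`0 < γ ≤ 1`):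

* §0 `sq_le_pFun` (`p(g) ≥ b₀(1 + log g⁻¹)²`, `p₀ ≥ 2`), `pFun_increment` (`p(g') − p(g) ≥ b₀(log g'⁻¹ − log g⁻¹)`, `p₀ ≥ 1`),
  `log_inv_coupling_eq` / `log_inv_coupling_add` (`log g_h⁻¹ = (h log L − log γ)/2`), `coupling_anti`, `scheme_β_add` (`β_{h+d} = β_h L^d`),
  `sqrt_pow_nine_le_pow_five` (`1 ≤ 1 + log g⁻¹` and `1 ≤ β_h` are the tree's `B2Prop31Thresholds.one_le_u` and an inlined four-liner);
* §3 (E1) `exp_pFun_deeper_le`: `e^{−ε p(g_{K−i})}·L^{3(j−i)} ≤ e^{−ε p(g_{K−j})}·L^{−(j−i)}` for `ε b₀ ≥ 8`; (E2) `exp_pFun_le_logSq`: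
  `e^{−ε p(g)} ≤ e^{−8(1 + log g⁻¹)²}`; (E3) `bare_level_le`: `L^{3j}·(√β_K)⁹·e^{−p(g_K)²/4} ≤ β_{K−j}⁵·e^{−8(1 + log g_{K−j}⁻¹)²}` for `b₀² ≥ 32`.

References: T. Bałaban, CMP 102 (1985) 255–275, (3) p.256, (7) p.257, (71) p.273 [Balaban1985UV3].

HONEST FRAMING: the crux `LocalInsertionL` (stmt-QuantumFields-23607, XL — zero provers per critic #188 (1)) and the route's residual
cruxes 20520 / 19200 are OPEN; this serves the glue item `HistoryTailOfInsertionL` (stmt-QuantumFields-23608) only; no rung (R3 =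
`YM3TorusSU2` is a RECORD rung), no summit, no continuum limit and no mass gap is proved by any of this.  Cell `ym-idea-1`, width seat
`ym-line-sfw-p2-w5` g12 (R3 family; free hands).  THEOREMS ONLY, definition-free.
-/

set_option autoImplicit false

noncomputable section

open scoped BigOperators
open MeasureTheory Filter Topology
open Literature.MathematicalPhysics.QuantumFieldTheory.Balaban1983to89
open Literature.MathematicalPhysics.QuantumFieldTheory.Balaban1983to89.T3ContinuumYM3Torus
open Literature.MathematicalPhysics.QuantumFieldTheory.Balaban1983to89.T3UnitScaleTilt
open Literature.MathematicalPhysics.QuantumFieldTheory.Balaban1983to89.T3UnitLawDensityEML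

namespace Summit.QuantumFields.YangMills.Theorems.LocalInsertion.HistoryTailOfInsertion

/-! ## §0 Real-analysis bookkeeping for Bałaban's `p`-function `p(g) = b₀(1 + log g⁻¹)^{p₀}` -/

/-- `p(g) ≥ b₀(1 + log g⁻¹)²` for `0 < g ≤ 1`, `b₀ ≥ 0`, `p₀ ≥ 2`. [cite: Balaban1985UV3, (7) p.257] -/
theorem sq_le_pFun {b₀ p₀ g : ℝ} (hb₀ : 0 ≤ b₀) (hp₀ : 2 ≤ p₀) (hg : 0 < g) (hg1 : g ≤ 1) :
    b₀ * (1 + Real.log g⁻¹) ^ 2 ≤ B10.pFun b₀ p₀ g := by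
  unfold B10.pFun
  have hx := Literature.MathematicalPhysics.QuantumFieldTheory.Balaban1983to89.B2Prop31Thresholds.one_le_u hg hg1
  have h : (1 + Real.log g⁻¹) ^ ((2 : ℕ) : ℝ) ≤ (1 + Real.log g⁻¹) ^ p₀ :=
    Real.rpow_le_rpow_of_exponent_le hx (by exact_mod_cast hp₀)
  rw [Real.rpow_natCast] at h
  exact mul_le_mul_of_nonneg_left h hb₀

/-- Monotone increments of real powers above `1`: `y − x ≤ y^p − x^p` for `1 ≤ x ≤ y`, `p ≥ 1`. [folklore] -/
theorem sub_le_rpow_sub_rpow {x y p : ℝ} (hx : 1 ≤ x) (hxy : x ≤ y) (hp : 1 ≤ p) : y - x ≤ y ^ p - x ^ p := by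
  have hx0 : 0 < x := by linarith
  have hy0 : 0 < y := by linarith
  have hA : x ^ (p - 1) ≤ y ^ (p - 1) := Real.rpow_le_rpow hx0.le hxy (by linarith)
  have hB : 1 ≤ x ^ (p - 1) := Real.one_le_rpow hx (by linarith)
  have ey : y ^ p = y ^ (p - 1) * y := by
    rw [Real.rpow_sub_one hy0.ne', div_mul_cancel₀ _ hy0.ne']
  have ex : x ^ p = x ^ (p - 1) * x := by
    rw [Real.rpow_sub_one hx0.ne', div_mul_cancel₀ _ hx0.ne']
  rw [ey, ex]
  nlinarith

/-- **Increments of the `p`-function**: `p(g') − p(g) ≥ b₀(log g'⁻¹ − log g⁻¹)` for `0 < g' ≤ g ≤ 1`, `b₀ ≥ 0`, `p₀ ≥ 1`.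
[cite: Balaban1985UV3, (7) p.257] -/
theorem pFun_increment {b₀ p₀ g g' : ℝ} (hb₀ : 0 ≤ b₀) (hp₀ : 1 ≤ p₀) (hg' : 0 < g') (hg'g : g' ≤ g) (hg1 : g ≤ 1) :
    b₀ * (Real.log g'⁻¹ - Real.log g⁻¹) ≤ B10.pFun b₀ p₀ g' - B10.pFun b₀ p₀ g := by
  unfold B10.pFun
  have hg : 0 < g := lt_of_lt_of_le hg' hg'g
  have hx := Literature.MathematicalPhysics.QuantumFieldTheory.Balaban1983to89.B2Prop31Thresholds.one_le_u hg hg1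
  have hxy : 1 + Real.log g⁻¹ ≤ 1 + Real.log g'⁻¹ := by
    have := Real.log_le_log (inv_pos.2 hg) ((inv_le_inv₀ hg hg').2 hg'g)
    linarith
  have h := sub_le_rpow_sub_rpow hx hxy hp₀
  rw [← mul_sub]
  exact mul_le_mul_of_nonneg_left (by linarith) hb₀

/-- **The effective couplings**: `log g_h⁻¹ = (h·log L − log γ)/2` for `g_h = √(γ L^{−h})`. [cite: Balaban1985UV3, (3) p.256] -/
theorem log_inv_coupling_eq {L : ℕ} (hL : 1 ≤ L) {γ : ℝ} (hγ : 0 < γ) (h : ℕ) :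
    Real.log (Real.sqrt (γ * ((L : ℝ)⁻¹) ^ h))⁻¹ = ((h : ℝ) * Real.log L - Real.log γ) / 2 := by
  have hL0 : (0 : ℝ) < L := by exact_mod_cast hL
  have hx : 0 < γ * ((L : ℝ)⁻¹) ^ h := mul_pos hγ (pow_pos (inv_pos.2 hL0) h)
  rw [Real.log_inv, Real.log_sqrt hx.le, Real.log_mul hγ.ne' (pow_pos (inv_pos.2 hL0) h).ne', Real.log_pow,
    Real.log_inv]
  ring

/-- Height shift of the couplings: `log g_{h+d}⁻¹ = log g_h⁻¹ + d·log L/2`. [cite: Balaban1985UV3, (3) p.256] -/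
theorem log_inv_coupling_add {L : ℕ} (hL : 1 ≤ L) {γ : ℝ} (hγ : 0 < γ) (h d : ℕ) :
    Real.log (Real.sqrt (γ * ((L : ℝ)⁻¹) ^ (h + d)))⁻¹ =
      Real.log (Real.sqrt (γ * ((L : ℝ)⁻¹) ^ h))⁻¹ + (d : ℝ) * Real.log L / 2 := by
  rw [log_inv_coupling_eq hL hγ, log_inv_coupling_eq hL hγ]
  push_cast
  ring

/-- The couplings decrease with the height: `g_{h+d} ≤ g_h`. [cite: Balaban1985UV3, (3) p.256] -/
theorem coupling_anti {L : ℕ} (hL : 1 ≤ L) {γ : ℝ} (hγ : 0 < γ) (h d : ℕ) :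
    Real.sqrt (γ * ((L : ℝ)⁻¹) ^ (h + d)) ≤ Real.sqrt (γ * ((L : ℝ)⁻¹) ^ h) := by
  apply Real.sqrt_le_sqrt
  apply mul_le_mul_of_nonneg_left _ hγ.le
  rw [pow_add]
  have hL1 : (1 : ℝ) ≤ L := by exact_mod_cast hL
  have hi : ((L : ℝ)⁻¹) ^ d ≤ 1 := pow_le_one₀ (inv_nonneg.2 (by linarith)) (inv_le_one_of_one_le₀ hL1)
  have h0 : 0 ≤ ((L : ℝ)⁻¹) ^ h := pow_nonneg (inv_nonneg.2 (by linarith)) h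
  nlinarith

/-- The inverse couplings of the scheme: `β_h = (γ L^{−h})⁻¹`, so `β_{h+d} = β_h · L^d` and `1 ≤ β_h` for `γ ≤ 1`.
[cite: Balaban1985UV3, (1)-(3) p.256] -/
theorem scheme_β_add (F : T3Family) (γ : ℝ) (h d : ℕ) :
    (F.scheme ℰp γ).β (h + d) = (F.scheme ℰp γ).β h * (F.L : ℝ) ^ d := by
  have hL0 : (0 : ℝ) < F.L := by exact_mod_cast lt_trans zero_lt_one F.hL.2
  show (γ * ((F.L : ℝ)⁻¹) ^ (h + d))⁻¹ = (γ * ((F.L : ℝ)⁻¹) ^ h)⁻¹ * (F.L : ℝ) ^ d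
  rw [pow_add, ← mul_assoc, mul_inv, inv_pow, inv_pow, inv_inv]

/-- `(√β)⁹ ≤ β⁵` for `β ≥ 1`. [folklore] -/
theorem sqrt_pow_nine_le_pow_five {β : ℝ} (hβ : 1 ≤ β) : Real.sqrt β ^ 9 ≤ β ^ 5 := by
  have hβ0 : 0 ≤ β := zero_le_one.trans hβ
  have hs : Real.sqrt β ^ 2 = β := Real.sq_sqrt hβ0
  have hsβ : Real.sqrt β ≤ β := by
    rw [Real.sqrt_le_left hβ0]
    nlinarith
  calc Real.sqrt β ^ 9 = (Real.sqrt β ^ 2) ^ 4 * Real.sqrt β := by ring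
    _ = β ^ 4 * Real.sqrt β := by rw [hs]
    _ ≤ β ^ 4 * β := by gcongr
    _ = β ^ 5 := by ring


/-! ## §3 Exponent bookkeeping: the linear `p`-increments absorb the local volumes -/

/-- (E1) **Deeper levels pay for their volume**: for `i ≤ j ≤ K` and `ε b₀ ≥ 8`,
`e^{−ε p(g_{K−i})}·(L^{j−i})³ ≤ e^{−ε p(g_{K−j})}·L^{−(j−i)}` (`p(g_{K−i}) − p(g_{K−j}) ≥ b₀(j−i)·log L/2`).
[cite: Balaban1985UV3, (7) p.257] -/
theorem exp_pFun_deeper_le (F : T3Family) {γ b₀ p₀ ε : ℝ} (hγ : 0 < γ) (hγ1 : γ ≤ 1) (hb₀ : 0 ≤ b₀) (hp₀ : 1 ≤ p₀)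
    (hε : 0 ≤ ε) (hεb : 8 ≤ ε * b₀) {K i j : ℕ} (hij : i ≤ j) (hjK : j ≤ K) :
    Real.exp (-(ε * B10.pFun b₀ p₀ (Real.sqrt (γ * ((F.L : ℝ)⁻¹) ^ (K - i))))) * ((F.L : ℝ) ^ (j - i)) ^ 3 ≤
      Real.exp (-(ε * B10.pFun b₀ p₀ (Real.sqrt (γ * ((F.L : ℝ)⁻¹) ^ (K - j))))) * ((F.L : ℝ)⁻¹) ^ (j - i) := by
  have hL2 : 2 ≤ F.L := F.hL.2
  have hL1 : 1 ≤ F.L := by omega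
  have hL1r : (1 : ℝ) ≤ F.L := by exact_mod_cast hL1
  have hL0 : (0 : ℝ) < F.L := by linarith
  have hlogL : 0 ≤ Real.log F.L := Real.log_nonneg hL1r
  have hKi : K - i = (K - j) + (j - i) := by omega
  set d : ℕ := j - i with hd
  -- the couplings
  have hgj : 0 < Real.sqrt (γ * ((F.L : ℝ)⁻¹) ^ (K - j)) ∧ Real.sqrt (γ * ((F.L : ℝ)⁻¹) ^ (K - j)) ≤ 1 := by
    obtain ⟨h1, h2, -, -⟩ :=
      Summit.QuantumFields.YangMills.Theorems.PoincareLipschitz.TwoSidedOfConcentration.coupling_basic hL1 hγ hγ1 (K - j)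
    exact ⟨h1, h2⟩
  have hgi : 0 < Real.sqrt (γ * ((F.L : ℝ)⁻¹) ^ (K - i)) := by
    obtain ⟨h1, -, -, -⟩ :=
      Summit.QuantumFields.YangMills.Theorems.PoincareLipschitz.TwoSidedOfConcentration.coupling_basic hL1 hγ hγ1 (K - i)
    exact h1
  have hanti : Real.sqrt (γ * ((F.L : ℝ)⁻¹) ^ (K - i)) ≤ Real.sqrt (γ * ((F.L : ℝ)⁻¹) ^ (K - j)) := by
    rw [hKi]; exact coupling_anti hL1 hγ (K - j) d
  -- the increment of the `p`-function
  have hinc := pFun_increment (b₀ := b₀) (p₀ := p₀) hb₀ hp₀ hgi hanti hgj.2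
  have hℓ : Real.log (Real.sqrt (γ * ((F.L : ℝ)⁻¹) ^ (K - i)))⁻¹ -
      Real.log (Real.sqrt (γ * ((F.L : ℝ)⁻¹) ^ (K - j)))⁻¹ = (d : ℝ) * Real.log F.L / 2 := by
    rw [hKi, log_inv_coupling_add hL1 hγ (K - j) d]; ring
  rw [hℓ] at hinc
  -- `ε (p_i − p_j) ≥ 4 d log L`
  have hkey : 4 * ((d : ℝ) * Real.log F.L) ≤
      ε * B10.pFun b₀ p₀ (Real.sqrt (γ * ((F.L : ℝ)⁻¹) ^ (K - i))) -
        ε * B10.pFun b₀ p₀ (Real.sqrt (γ * ((F.L : ℝ)⁻¹) ^ (K - j))) := by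
    have h1 : ε * (b₀ * ((d : ℝ) * Real.log F.L / 2)) ≤
        ε * (B10.pFun b₀ p₀ (Real.sqrt (γ * ((F.L : ℝ)⁻¹) ^ (K - i))) -
          B10.pFun b₀ p₀ (Real.sqrt (γ * ((F.L : ℝ)⁻¹) ^ (K - j)))) := mul_le_mul_of_nonneg_left hinc hε
    have h2 : 4 * ((d : ℝ) * Real.log F.L) ≤ ε * (b₀ * ((d : ℝ) * Real.log F.L / 2)) := by
      have : 0 ≤ (d : ℝ) * Real.log F.L := by positivity
      nlinarith
    linarith
  -- `exp(4 d log L) = (L^d)^4`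
  have hexp : Real.exp (4 * ((d : ℝ) * Real.log F.L)) = ((F.L : ℝ) ^ d) ^ 4 := by
    rw [show 4 * ((d : ℝ) * Real.log F.L) = ((4 * d : ℕ) : ℝ) * Real.log F.L by push_cast; ring, Real.exp_nat_mul,
      Real.exp_log hL0, pow_mul']
  have hLd : 0 < (F.L : ℝ) ^ d := pow_pos hL0 d
  -- assemble
  have h3 : Real.exp (-(ε * B10.pFun b₀ p₀ (Real.sqrt (γ * ((F.L : ℝ)⁻¹) ^ (K - i))))) ≤
      Real.exp (-(ε * B10.pFun b₀ p₀ (Real.sqrt (γ * ((F.L : ℝ)⁻¹) ^ (K - j))))) * (((F.L : ℝ) ^ d) ^ 4)⁻¹ := by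
    rw [← hexp, ← Real.exp_neg, ← Real.exp_add]
    exact Real.exp_le_exp.2 (by linarith)
  calc Real.exp (-(ε * B10.pFun b₀ p₀ (Real.sqrt (γ * ((F.L : ℝ)⁻¹) ^ (K - i))))) * ((F.L : ℝ) ^ d) ^ 3
      ≤ (Real.exp (-(ε * B10.pFun b₀ p₀ (Real.sqrt (γ * ((F.L : ℝ)⁻¹) ^ (K - j))))) * (((F.L : ℝ) ^ d) ^ 4)⁻¹) *
          ((F.L : ℝ) ^ d) ^ 3 := mul_le_mul_of_nonneg_right h3 (by positivity)
    _ = Real.exp (-(ε * B10.pFun b₀ p₀ (Real.sqrt (γ * ((F.L : ℝ)⁻¹) ^ (K - j))))) * ((F.L : ℝ)⁻¹) ^ d := by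
        have hne : (F.L : ℝ) ^ d ≠ 0 := hLd.ne'
        rw [inv_pow, mul_assoc]
        congr 1
        rw [show ((F.L : ℝ) ^ d) ^ 4 = ((F.L : ℝ) ^ d) ^ 3 * (F.L : ℝ) ^ d by ring, mul_inv,
          mul_comm (((F.L : ℝ) ^ d) ^ 3)⁻¹, mul_assoc, inv_mul_cancel₀ (pow_ne_zero 3 hne), mul_one]
        exact (inv_pow _ _).symm

/-- (E2) **The linear-exponential tail is log-square**: `e^{−ε p(g)} ≤ e^{−8(1 + log g⁻¹)²}` for `ε b₀ ≥ 8`, `p₀ ≥ 2`, `0 < g ≤ 1`.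
[cite: Balaban1985UV3, (7) p.257] -/
theorem exp_pFun_le_logSq {γx b₀ p₀ ε : ℝ} (hg : 0 < γx) (hg1 : γx ≤ 1) (hb₀ : 0 ≤ b₀) (hp₀ : 2 ≤ p₀) (hε : 0 ≤ ε)
    (hεb : 8 ≤ ε * b₀) :
    Real.exp (-(ε * B10.pFun b₀ p₀ γx)) ≤ Real.exp (-(8 * (1 + Real.log γx⁻¹) ^ 2)) := by
  have h1 := sq_le_pFun hb₀ hp₀ hg hg1
  have h2 : 8 * (1 + Real.log γx⁻¹) ^ 2 ≤ ε * B10.pFun b₀ p₀ γx := by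
    have h3 : ε * (b₀ * (1 + Real.log γx⁻¹) ^ 2) ≤ ε * B10.pFun b₀ p₀ γx := mul_le_mul_of_nonneg_left h1 hε
    have h4 : 0 ≤ (1 + Real.log γx⁻¹) ^ 2 := sq_nonneg _
    nlinarith
  exact Real.exp_le_exp.2 (by linarith)

/-- (E3) **The bare level pays for its volume**: for `j ≤ K`, `b₀² ≥ 32`, `p₀ ≥ 2`, `0 < γ ≤ 1`,
`(L^j)³·(√β_K)⁹·e^{−p(g_K)²/4} ≤ β_{K−j}⁵·e^{−8(1 + log g_{K−j}⁻¹)²}` (`β_K = β_{K−j}L^j`, `(1 + log g_K⁻¹)² ≥ (1 + log g_{K−j}⁻¹)² + j·log L`).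
[cite: Balaban1985UV3, (71) p.273] -/
theorem bare_level_le (F : T3Family) {γ b₀ p₀ : ℝ} (hγ : 0 < γ) (hγ1 : γ ≤ 1) (hb₀ : 0 ≤ b₀) (hb32 : 32 ≤ b₀ ^ 2)
    (hp₀ : 2 ≤ p₀) {K j : ℕ} (hjK : j ≤ K) :
    ((F.L : ℝ) ^ j) ^ 3 * Real.sqrt ((F.scheme ℰp γ).β K) ^ 9 *
        Real.exp (-(B10.pFun b₀ p₀ (Real.sqrt (γ * ((F.L : ℝ)⁻¹) ^ K)) ^ 2 / 4)) ≤
      (F.scheme ℰp γ).β (K - j) ^ 5 * Real.exp (-(8 * (1 + Real.log (Real.sqrt (γ * ((F.L : ℝ)⁻¹) ^ (K - j)))⁻¹) ^ 2)) := by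
  have hL2 : 2 ≤ F.L := F.hL.2
  have hL1 : 1 ≤ F.L := by omega
  have hL1r : (1 : ℝ) ≤ F.L := by exact_mod_cast hL1
  have hL0 : (0 : ℝ) < F.L := by linarith
  have hlogL : 0 ≤ Real.log F.L := Real.log_nonneg hL1r
  have hK : K = (K - j) + j := by omega
  -- `β_K = β_{K−j} L^j`, `β ≥ 1`
  have hβ : (F.scheme ℰp γ).β K = (F.scheme ℰp γ).β (K - j) * (F.L : ℝ) ^ j := by
    conv_lhs => rw [hK]
    exact scheme_β_add F γ (K - j) j
  have hβ1 : 1 ≤ (F.scheme ℰp γ).β K := (by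
      have hL1r : (1 : ℝ) ≤ F.L := by exact_mod_cast F.hL.2.le
      show 1 ≤ (γ * ((F.L : ℝ)⁻¹) ^ K)⁻¹
      have hx0 : 0 < γ * ((F.L : ℝ)⁻¹) ^ K := mul_pos hγ (pow_pos (inv_pos.2 (by linarith)) _)
      rw [one_le_inv₀ hx0]
      calc γ * ((F.L : ℝ)⁻¹) ^ K ≤ 1 * 1 :=
            mul_le_mul hγ1 (pow_le_one₀ (inv_nonneg.2 (by linarith)) (inv_le_one_of_one_le₀ hL1r)) (by positivity) zero_le_one
        _ = 1 := one_mul _)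
  have hβj0 : 0 ≤ (F.scheme ℰp γ).β (K - j) := zero_le_one.trans ((by
      have hL1r : (1 : ℝ) ≤ F.L := by exact_mod_cast F.hL.2.le
      show 1 ≤ (γ * ((F.L : ℝ)⁻¹) ^ (K - j))⁻¹
      have hx0 : 0 < γ * ((F.L : ℝ)⁻¹) ^ (K - j) := mul_pos hγ (pow_pos (inv_pos.2 (by linarith)) _)
      rw [one_le_inv₀ hx0]
      calc γ * ((F.L : ℝ)⁻¹) ^ (K - j) ≤ 1 * 1 :=
            mul_le_mul hγ1 (pow_le_one₀ (inv_nonneg.2 (by linarith)) (inv_le_one_of_one_le₀ hL1r)) (by positivity) zero_le_one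
        _ = 1 := one_mul _))
  have hsqrt : Real.sqrt ((F.scheme ℰp γ).β K) ^ 9 ≤ (F.scheme ℰp γ).β K ^ 5 := sqrt_pow_nine_le_pow_five hβ1
  -- couplings at heights `K` and `K − j`
  obtain ⟨hgK, hgK1, -, -⟩ :=
    Summit.QuantumFields.YangMills.Theorems.PoincareLipschitz.TwoSidedOfConcentration.coupling_basic hL1 hγ hγ1 K
  obtain ⟨hgj, hgj1, -, -⟩ :=
    Summit.QuantumFields.YangMills.Theorems.PoincareLipschitz.TwoSidedOfConcentration.coupling_basic hL1 hγ hγ1 (K - j)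
  set ℓK : ℝ := Real.log (Real.sqrt (γ * ((F.L : ℝ)⁻¹) ^ K))⁻¹ with hℓK
  set ℓj : ℝ := Real.log (Real.sqrt (γ * ((F.L : ℝ)⁻¹) ^ (K - j)))⁻¹ with hℓj
  have hℓ : ℓK = ℓj + (j : ℝ) * Real.log F.L / 2 := by
    rw [hℓK, hℓj, hK, log_inv_coupling_add hL1 hγ (K - j) j, Nat.add_sub_cancel]
  have hxj : 1 ≤ 1 + ℓj := Literature.MathematicalPhysics.QuantumFieldTheory.Balaban1983to89.B2Prop31Thresholds.one_le_u hgj hgj1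
  -- `p(g_K)²/4 ≥ 8(1+ℓK)² ≥ 8(1+ℓj)² + 8 j log L`
  have hp1 : b₀ * (1 + ℓK) ^ 2 ≤ B10.pFun b₀ p₀ (Real.sqrt (γ * ((F.L : ℝ)⁻¹) ^ K)) := sq_le_pFun hb₀ hp₀ hgK hgK1
  have hxK : 1 ≤ 1 + ℓK := Literature.MathematicalPhysics.QuantumFieldTheory.Balaban1983to89.B2Prop31Thresholds.one_le_u hgK hgK1
  have hp2 : 8 * (1 + ℓK) ^ 2 ≤ B10.pFun b₀ p₀ (Real.sqrt (γ * ((F.L : ℝ)⁻¹) ^ K)) ^ 2 / 4 := by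
    have h0 : 0 ≤ b₀ * (1 + ℓK) ^ 2 := by positivity
    have h1 : (b₀ * (1 + ℓK) ^ 2) ^ 2 ≤ B10.pFun b₀ p₀ (Real.sqrt (γ * ((F.L : ℝ)⁻¹) ^ K)) ^ 2 :=
      pow_le_pow_left₀ h0 hp1 2
    have h2 : (1 : ℝ) ≤ (1 + ℓK) ^ 2 := one_le_pow₀ hxK
    have h2' : (1 + ℓK) ^ 2 ≤ ((1 + ℓK) ^ 2) ^ 2 := le_self_pow₀ h2 (by norm_num)
    have h3 : 32 * (1 + ℓK) ^ 2 ≤ b₀ ^ 2 * ((1 + ℓK) ^ 2) ^ 2 :=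
      mul_le_mul hb32 h2' (by positivity) (by positivity)
    have h4 : (b₀ * (1 + ℓK) ^ 2) ^ 2 = b₀ ^ 2 * ((1 + ℓK) ^ 2) ^ 2 := by ring
    rw [h4] at h1
    linarith
  have hp3 : (1 + ℓj) ^ 2 + (j : ℝ) * Real.log F.L ≤ (1 + ℓK) ^ 2 := by
    rw [hℓ]
    have : 0 ≤ (j : ℝ) * Real.log F.L := by positivity
    nlinarith
  -- `exp(−p²/4) ≤ exp(−8(1+ℓj)²)·(L^j)^{-8}`
  have hexp : Real.exp (8 * ((j : ℝ) * Real.log F.L)) = ((F.L : ℝ) ^ j) ^ 8 := by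
    rw [show 8 * ((j : ℝ) * Real.log F.L) = ((8 * j : ℕ) : ℝ) * Real.log F.L by push_cast; ring, Real.exp_nat_mul,
      Real.exp_log hL0, pow_mul']
  have hLj : 0 < (F.L : ℝ) ^ j := pow_pos hL0 j
  have h4 : Real.exp (-(B10.pFun b₀ p₀ (Real.sqrt (γ * ((F.L : ℝ)⁻¹) ^ K)) ^ 2 / 4)) ≤
      Real.exp (-(8 * (1 + ℓj) ^ 2)) * (((F.L : ℝ) ^ j) ^ 8)⁻¹ := by
    rw [← hexp, ← Real.exp_neg, ← Real.exp_add]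
    exact Real.exp_le_exp.2 (by linarith)
  calc ((F.L : ℝ) ^ j) ^ 3 * Real.sqrt ((F.scheme ℰp γ).β K) ^ 9 *
        Real.exp (-(B10.pFun b₀ p₀ (Real.sqrt (γ * ((F.L : ℝ)⁻¹) ^ K)) ^ 2 / 4))
      ≤ ((F.L : ℝ) ^ j) ^ 3 * (F.scheme ℰp γ).β K ^ 5 *
          (Real.exp (-(8 * (1 + ℓj) ^ 2)) * (((F.L : ℝ) ^ j) ^ 8)⁻¹) := by
        gcongr
    _ = (F.scheme ℰp γ).β (K - j) ^ 5 * Real.exp (-(8 * (1 + ℓj) ^ 2)) := by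
        rw [hβ]; field_simp



end Summit.QuantumFields.YangMills.Theorems.LocalInsertion.HistoryTailOfInsertion

end
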